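import Summits.MatrixMultiplication.OmegaCensus.STPP222IcosetHSearch
import Mathlib.Data.Nat.Bitwise
import Mathlib.Data.List.GetD
import Mathlib.Algebra.Group.Basic
import Mathlib.Tactic.Ring
import Mathlib.Tactic.Abel

/-!
# ω-census, icoset class negatives: SOUNDNESS of the kernel H-stage search engine

HONEST FRAMING (pub-omega census; verbatim): lottery ticket; floor = certified bounds/negative ranges.
Census STRUCTURE bookkeeping (Q7, the involution-coset class), nothing about `ω`.

Semantics of `STPP222IcosetHSearch.lean`: the recursor-form primitives compute what their names say (`forceL_eq`, `getI_eq_getD`,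
`applyMerges_eq`, …) and **`IcosetH.check_sound`**: if `check A K = true` for a code arithmetic `A` that correctly ENCODES the finite
abelian group `H` (`IcosetH.Enc`: an injective `enc : H → ℕ` with `enc 0 = 0`, codes `< nEl`, `addC`/`subC` = `+`/`−` on codes), then
there are NO `b c : ℕ → H` and slot labelling `P : ℕ → Λ` (slots `3t, 3t+1, 3t+2` = `AB_t, BC_t, AC_t`) with `b 0 = c 0 = 0`, codes of
`b` increasing on `[0, K)`, `c` and `b − c` injective on `[0, K)`, every zero triple (`i j k < K` pairwise distinct with
`b j + c k = b i + c j`) labelled constantly on `AB_i, BC_j, AC_k`, and the three slots of each triple labelled pairwise differently.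
The link from icoset STPP families to such `(b, c, P)` (normal form + sorting + planes) is `STPP222IcosetClassNone*.lean`.
Seat pub-omega-kernel-l4 (gen 19), 2026-08-27.
-/

namespace Summit.MatrixMultiplication.OmegaCensus

namespace IcosetH

/-! ## Semantics of the primitives -/

/-- `forceL l f = f l`. -/
theorem forceL_eq (l : List ℕ) (f : List ℕ → Bool) : forceL l f = f l := by
  induction l generalizing f with
  | nil => rfl
  | cons x xs ih => cases x with | zero => exact ih _ | succ k => exact ih _

/-- `forceN n f = f n`. -/
theorem forceN_eq (n : ℕ) (f : ℕ → Bool) : forceN n f = f n := by cases n <;> rfl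

/-- `getI l i = l.getD i 0`. -/
theorem getI_eq_getD (l : List ℕ) (i : ℕ) : getI l i = l.getD i 0 := by
  induction l generalizing i with
  | nil => rfl
  | cons x xs ih => cases i with | zero => rfl | succ j => exact ih j

/-- `snoc l x = l ++ [x]`. -/
theorem snoc_eq (l : List ℕ) (x : ℕ) : snoc l x = l ++ [x] := by
  induction l with | nil => rfl | cons y ys ih => exact congrArg (List.cons y) ih

/-- `getI` below the length of an appended list reads the left part. -/
theorem getI_append_left {l : List ℕ} (x : ℕ) {i : ℕ} (hi : i < l.length) : getI (l ++ [x]) i = getI l i := by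
  rw [getI_eq_getD, getI_eq_getD, List.getD_eq_getElem?_getD, List.getD_eq_getElem?_getD, List.getElem?_append_left hi]

/-- `getI (l ++ [x]) l.length = x`. -/
theorem getI_append_length (l : List ℕ) (x : ℕ) : getI (l ++ [x]) l.length = x := by
  rw [getI_eq_getD, List.getD_eq_getElem?_getD, List.getElem?_append_right (le_refl _)]; simp

/-- `getI (List.range n) u = u` for `u < n`. -/
theorem getI_range {n u : ℕ} (hu : u < n) : getI (List.range n) u = u := by
  rw [getI_eq_getD, List.getD_eq_getElem?_getD, List.getElem?_range hu]; rfl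

/-- `allN n p = true` gives `p i = true` for every `i < n`. -/
theorem allN_true {n : ℕ} {p : ℕ → Bool} (h : allN n p = true) {i : ℕ} (hi : i < n) : p i = true := by
  induction n with
  | zero => exact absurd hi (Nat.not_lt_zero _)
  | succ n ih =>
    have h' : (allN n p && p n) = true := h
    rw [Bool.and_eq_true] at h'
    rcases Nat.lt_succ_iff_lt_or_eq.1 hi with hlt | rfl
    exacts [ih h'.1 hlt, h'.2]

/-- Conversely `allN n p = true` if `p i = true` for every `i < n`. -/
theorem allN_of_forall {n : ℕ} {p : ℕ → Bool} (h : ∀ i, i < n → p i = true) : allN n p = true := by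
  induction n with
  | zero => rfl
  | succ n ih =>
    show (allN n p && p n) = true
    exact Bool.and_eq_true_iff.2 ⟨ih fun i hi => h i (Nat.lt_succ_of_lt hi), h n (Nat.lt_succ_self n)⟩

/-- `anyN n p = true` gives some `i < n` with `p i = true`. -/
theorem anyN_true {n : ℕ} {p : ℕ → Bool} (h : anyN n p = true) : ∃ i, i < n ∧ p i = true := by
  induction n with
  | zero => exact absurd h (by simp [anyN])
  | succ n ih =>
    have h' : (anyN n p || p n) = true := h
    rcases Bool.or_eq_true_iff.1 h' with h' | h'
    · obtain ⟨i, hi, hp⟩ := ih h'; exact ⟨i, Nat.lt_succ_of_lt hi, hp⟩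
    · exact ⟨n, Nat.lt_succ_self n, h'⟩

/-- `relabel` is a `map`. -/
theorem relabel_eq_map (L : List ℕ) (a b : ℕ) : relabel L a b = L.map fun y => bif Nat.beq y a then b else y := by
  induction L with
  | nil => rfl
  | cons y ys ih =>
    show ((@Bool.rec (fun _ => ℕ) y b (Nat.beq y a)) :: relabel ys a b) = _
    rw [ih, List.map_cons]
    cases Nat.beq y a <;> rfl

/-- Length of `relabel`. -/
theorem length_relabel (L : List ℕ) (a b : ℕ) : (relabel L a b).length = L.length := by rw [relabel_eq_map, List.length_map]

/-- Entries of `relabel` below the length. -/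
theorem getI_relabel {L : List ℕ} (a b : ℕ) {u : ℕ} (hu : u < L.length) :
    getI (relabel L a b) u = if getI L u = a then b else getI L u := by
  rw [relabel_eq_map, getI_eq_getD, getI_eq_getD, List.getD_eq_getElem?_getD, List.getD_eq_getElem?_getD,
    List.getElem?_map, List.getElem?_eq_getElem hu]
  simp only [Option.map_some, Option.getD_some]
  by_cases h : L[u] = a
  · rw [if_pos h, show Nat.beq L[u] a = true by rw [h]; exact Nat.beq_refl a]; rfl
  · have : Nat.beq L[u] a = false := by
      cases hb : Nat.beq L[u] a with | false => rfl | true => exact absurd (Nat.eq_of_beq_eq_true hb) h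
    rw [if_neg h, this]; rfl

/-- Length of `merge3`. -/
theorem length_merge3 (L : List ℕ) (i j k : ℕ) : (merge3 L i j k).length = L.length := by
  simp only [merge3, length_relabel]

/-- Pure form of the merges: a left fold. -/
noncomputable def mergeAll (zs : List (ℕ × ℕ × ℕ)) (L : List ℕ) : List ℕ := zs.foldl (fun L z => merge3 L z.1 z.2.1 z.2.2) L

/-- `applyMerges zs L k = k (mergeAll zs L)`. -/
theorem applyMerges_eq (zs : List (ℕ × ℕ × ℕ)) (L : List ℕ) (k : List ℕ → Bool) :
    applyMerges zs L k = k (mergeAll zs L) := by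
  induction zs generalizing L with
  | nil => rfl
  | cons z zs ih => show forceL (merge3 L z.1 z.2.1 z.2.2) (fun L' => applyMerges zs L' k) = _; rw [forceL_eq, ih]; rfl

/-- Length of `mergeAll`. -/
theorem length_mergeAll (zs : List (ℕ × ℕ × ℕ)) (L : List ℕ) : (mergeAll zs L).length = L.length := by
  induction zs generalizing L with
  | nil => rfl | cons z zs ih => show (mergeAll zs (merge3 L _ _ _)).length = _; rw [ih, length_merge3]

/-- A clash names a triple `t < m1` two of whose slots carry the same label. -/
theorem clash_true {L : List ℕ} {m1 : ℕ} (h : clash L m1 = true) :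
    ∃ t, t < m1 ∧ (getI L (3*t) = getI L (3*t+1) ∨ getI L (3*t+1) = getI L (3*t+2) ∨ getI L (3*t) = getI L (3*t+2)) := by
  obtain ⟨t, ht, hp⟩ := anyN_true h
  refine ⟨t, ht, ?_⟩
  simp only [Bool.or_eq_true] at hp
  rcases hp with (hp | hp) | hp
  exacts [Or.inl (Nat.eq_of_beq_eq_true hp), Or.inr (Or.inl (Nat.eq_of_beq_eq_true hp)), Or.inr (Or.inr (Nat.eq_of_beq_eq_true hp))]

/-- What `zerosOrd` adds to the accumulator. -/
theorem mem_zerosOrd {A : CArith} {m x y i j bi ci bj cj : ℕ} {acc : List (ℕ × ℕ × ℕ)} {z : ℕ × ℕ × ℕ}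
    (hz : z ∈ zerosOrd A m x y i j bi ci bj cj acc) :
    z ∈ acc ∨ (z = (m, i, j) ∧ A.addC bi cj = A.addC x ci) ∨ (z = (i, m, j) ∧ A.addC x cj = A.addC bi y) ∨
      (z = (i, j, m) ∧ A.addC bj y = A.addC bi cj) := by
  unfold zerosOrd at hz
  have step : ∀ {t : Bool} {w : ℕ × ℕ × ℕ} {l : List (ℕ × ℕ × ℕ)} {P : Prop},
      z ∈ @Bool.rec (fun _ => List (ℕ × ℕ × ℕ)) l (w :: l) t → (t = true → P) → z ∈ l ∨ (z = w ∧ P) := by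
    intro t w l P hmem hP
    cases t with
    | false => exact Or.inl hmem
    | true => rcases List.mem_cons.1 hmem with rfl | h; exacts [Or.inr ⟨rfl, hP rfl⟩, Or.inl h]
  rcases step hz (fun h => Nat.eq_of_beq_eq_true h) with h3 | h3
  · rcases step h3 (fun h => Nat.eq_of_beq_eq_true h) with h2 | h2
    · rcases step h2 (fun h => Nat.eq_of_beq_eq_true h) with h1 | h1
      exacts [Or.inl h1, Or.inr (Or.inl h1)]
    · exact Or.inr (Or.inr (Or.inl h2))
  · exact Or.inr (Or.inr (Or.inr h3))

/-- The inner loop of `zeros` with the new index `m` decoupled from the loop bound. -/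
noncomputable def zerosLoop (A : CArith) (B C : List ℕ) (m x y : ℕ) (n : ℕ) : List (ℕ × ℕ × ℕ) :=
  @Nat.rec (fun _ => List (ℕ × ℕ × ℕ)) [] (fun i acc =>
    @Nat.rec (fun _ => List (ℕ × ℕ × ℕ)) acc (fun j acc =>
      zerosOrd A m x y j i (getI B j) (getI C j) (getI B i) (getI C i)
        (zerosOrd A m x y i j (getI B i) (getI C i) (getI B j) (getI C j) acc)) i) n

/-- `zeros` is `zerosLoop` at bound `m`. -/
theorem zeros_eq (A : CArith) (B C : List ℕ) (m x y : ℕ) : zeros A B C m x y = zerosLoop A B C m x y m := rfl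

/-- A member of the zero list is one of the three patterns for some ordered pair `i ≠ j` below the bound, with its code
identity. -/
theorem mem_zerosLoop {A : CArith} {B C : List ℕ} {m x y n : ℕ} {z : ℕ × ℕ × ℕ} (hz : z ∈ zerosLoop A B C m x y n) :
    ∃ i j, i < n ∧ j < n ∧ i ≠ j ∧
      ((z = (m, i, j) ∧ A.addC (getI B i) (getI C j) = A.addC x (getI C i)) ∨
       (z = (i, m, j) ∧ A.addC x (getI C j) = A.addC (getI B i) y) ∨
       (z = (i, j, m) ∧ A.addC (getI B j) y = A.addC (getI B i) (getI C j))) := by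
  induction n with
  | zero => exact absurd hz (by simp [zerosLoop])
  | succ n ih =>
    -- zerosLoop (n+1) = inner loop over j < n on top of zerosLoop n
    have hz' : z ∈ @Nat.rec (fun _ => List (ℕ × ℕ × ℕ)) (zerosLoop A B C m x y n) (fun j acc =>
        zerosOrd A m x y j n (getI B j) (getI C j) (getI B n) (getI C n)
          (zerosOrd A m x y n j (getI B n) (getI C n) (getI B j) (getI C j) acc)) n := hz
    clear hz
    -- inner induction over the bound of the `j`-loop
    suffices H : ∀ p, p ≤ n → z ∈ @Nat.rec (fun _ => List (ℕ × ℕ × ℕ)) (zerosLoop A B C m x y n) (fun j acc =>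
        zerosOrd A m x y j n (getI B j) (getI C j) (getI B n) (getI C n)
          (zerosOrd A m x y n j (getI B n) (getI C n) (getI B j) (getI C j) acc)) p →
        ∃ i j, i < n + 1 ∧ j < n + 1 ∧ i ≠ j ∧
          ((z = (m, i, j) ∧ A.addC (getI B i) (getI C j) = A.addC x (getI C i)) ∨
           (z = (i, m, j) ∧ A.addC x (getI C j) = A.addC (getI B i) y) ∨
           (z = (i, j, m) ∧ A.addC (getI B j) y = A.addC (getI B i) (getI C j))) from H n le_rfl hz'
    intro p
    induction p with
    | zero =>
      intro _ h0; obtain ⟨i, j, hi, hj, hne, hh⟩ := ih h0; exact ⟨i, j, Nat.lt_succ_of_lt hi, Nat.lt_succ_of_lt hj, hne, hh⟩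
    | succ p ihp =>
      intro hp hmem
      have hpn : p ≠ n := Nat.ne_of_lt (Nat.lt_of_succ_le hp)
      rcases mem_zerosOrd hmem with h | h | h | h
      · rcases mem_zerosOrd h with h' | h' | h' | h'
        · exact ihp (Nat.le_of_succ_le hp) h'
        · exact ⟨n, p, Nat.lt_succ_self n, Nat.lt_succ_of_lt (Nat.lt_of_succ_le hp), hpn.symm, Or.inl h'⟩
        · exact ⟨n, p, Nat.lt_succ_self n, Nat.lt_succ_of_lt (Nat.lt_of_succ_le hp), hpn.symm, Or.inr (Or.inl h')⟩
        · exact ⟨n, p, Nat.lt_succ_self n, Nat.lt_succ_of_lt (Nat.lt_of_succ_le hp), hpn.symm, Or.inr (Or.inr h')⟩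
      · exact ⟨p, n, Nat.lt_succ_of_lt (Nat.lt_of_succ_le hp), Nat.lt_succ_self n, hpn, Or.inl h⟩
      · exact ⟨p, n, Nat.lt_succ_of_lt (Nat.lt_of_succ_le hp), Nat.lt_succ_self n, hpn, Or.inr (Or.inl h)⟩
      · exact ⟨p, n, Nat.lt_succ_of_lt (Nat.lt_of_succ_le hp), Nat.lt_succ_self n, hpn, Or.inr (Or.inr h)⟩

/-- Bits of the forbidden mask: the used codes `c_i` and the codes `x + c_i − b_i`, `i < m`. -/
theorem testBit_forbMask {A : CArith} {B C : List ℕ} {m x y : ℕ} (h : Nat.testBit (forbMask A B C m x) y = true) :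
    ∃ i, i < m ∧ (y = getI C i ∨ y = A.subC (A.addC x (getI C i)) (getI B i)) := by
  induction m with
  | zero => exact absurd h (by simp [forbMask])
  | succ m ih =>
    have h' : Nat.testBit (Nat.lor (Nat.lor (forbMask A B C m x) (Nat.shiftLeft 1 (getI C m)))
        (Nat.shiftLeft 1 (A.subC (A.addC x (getI C m)) (getI B m)))) y = true := h
    have e1 : ∀ p : ℕ, Nat.testBit (Nat.shiftLeft 1 p) y = true → y = p := by
      intro p hp
      rw [Nat.shiftLeft_eq', Nat.one_shiftLeft, Nat.testBit_two_pow] at hp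
      exact (of_decide_eq_true hp).symm
    change Nat.testBit ((forbMask A B C m x ||| Nat.shiftLeft 1 (getI C m)) |||
        Nat.shiftLeft 1 (A.subC (A.addC x (getI C m)) (getI B m))) y = true at h'
    rw [Nat.testBit_lor, Nat.testBit_lor, Bool.or_eq_true, Bool.or_eq_true] at h'
    rcases h' with (h' | h') | h'
    · obtain ⟨i, hi, hh⟩ := ih h'; exact ⟨i, Nat.lt_succ_of_lt hi, hh⟩
    exacts [⟨m, Nat.lt_succ_self m, Or.inl (e1 _ h')⟩, ⟨m, Nat.lt_succ_self m, Or.inr (e1 _ h')⟩]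

/-- `dfs` at `r = 0` finds a completed assignment: `false`. -/
theorem dfs_zero (A : CArith) (m : ℕ) (B C L : List ℕ) : dfs A 0 m B C L = false := rfl
/-- One level of `dfs`. -/
theorem dfs_succ (A : CArith) (r m : ℕ) (B C L : List ℕ) : dfs A (r + 1) m B C L =
    allN A.nEl (fun x => Nat.ble x (getI B (m - 1)) || forceN (forbMask A B C m x) fun fm => allN A.nEl fun y =>
      Nat.testBit fm y || applyMerges (zeros A B C m x y) L fun L' =>
        clash L' (m + 1) || forceL (snoc B x) fun B' => forceL (snoc C y) fun C' => dfs A r (m + 1) B' C' L') := rfl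

/-! ## Encodings and the soundness theorem -/

/-- A correct ENCODING of the additive group `H` by the code arithmetic `A`: an injective code map with `enc 0 = 0`, all codes
below `A.nEl`, and `addC`/`subC` computing `+`/`−` on codes. -/
structure Enc (H : Type*) [AddCommGroup H] (A : CArith) where
  /-- the code of an element -/ enc : H → ℕ
  /-- codes are faithful -/ inj : Function.Injective enc
  /-- the code of `0` -/ enc_zero : enc 0 = 0
  /-- codes are below the number of codes -/ enc_lt : ∀ h, enc h < A.nEl
  /-- `addC` is addition -/ addC_enc : ∀ u v, A.addC (enc u) (enc v) = enc (u + v)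
  /-- `subC` is subtraction -/ subC_enc : ∀ u v, A.subC (enc u) (enc v) = enc (u - v)

section Sound
variable {H : Type*} [AddCommGroup H] {A : CArith} (E : Enc H A) {Λ : Type*}

/-- The label invariant: equal labels below `3K` force equal planes. -/
def LInv (K : ℕ) (P : ℕ → Λ) (L : List ℕ) : Prop :=
  L.length = 3 * K ∧ ∀ u v, u < 3 * K → v < 3 * K → getI L u = getI L v → P u = P v

/-- A merge justified by two label-respecting equalities keeps the invariant. -/
theorem linv_relabel {K : ℕ} {P : ℕ → Λ} {L : List ℕ} (hL : LInv K P L) {u0 v0 : ℕ} (hu0 : u0 < 3 * K) (hv0 : v0 < 3 * K)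
    (hP : P u0 = P v0) : LInv K P (relabel L (getI L u0) (getI L v0)) := by
  refine ⟨by rw [length_relabel, hL.1], fun u v hu hv h => ?_⟩
  have huL : u < L.length := hL.1 ▸ hu
  have hvL : v < L.length := hL.1 ▸ hv
  rw [getI_relabel _ _ huL, getI_relabel _ _ hvL] at h
  by_cases hua : getI L u = getI L u0 <;> by_cases hva : getI L v = getI L u0
  · exact hL.2 u v hu hv (hua.trans hva.symm)
  · rw [if_pos hua, if_neg hva] at h
    exact (hL.2 u u0 hu hu0 hua).trans (hP.trans (hL.2 v0 v hv0 hv h))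
  · rw [if_neg hua, if_pos hva] at h
    exact (hL.2 u v0 hu hv0 h).trans (hP.symm.trans (hL.2 u0 v hu0 hv hva.symm))
  · rw [if_neg hua, if_neg hva] at h
    exact hL.2 u v hu hv h

/-- `merge3` along a genuine zero triple keeps the invariant. -/
theorem linv_merge3 {K : ℕ} {P : ℕ → Λ} {L : List ℕ} (hL : LInv K P L) {i j k : ℕ} (hi : i < K) (hj : j < K) (hk : k < K)
    (h1 : P (3 * i) = P (3 * j + 1)) (h2 : P (3 * j + 1) = P (3 * k + 2)) : LInv K P (merge3 L i j k) := by
  unfold merge3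
  exact linv_relabel (linv_relabel hL (by omega) (by omega) h1) (by omega) (by omega) h2

/-- `mergeAll` along genuine zero triples keeps the invariant. -/
theorem linv_mergeAll {K : ℕ} {P : ℕ → Λ} (zs : List (ℕ × ℕ × ℕ))
    (hzs : ∀ z ∈ zs, z.1 < K ∧ z.2.1 < K ∧ z.2.2 < K ∧ P (3 * z.1) = P (3 * z.2.1 + 1) ∧ P (3 * z.2.1 + 1) = P (3 * z.2.2 + 2))
    {L : List ℕ} (hL : LInv K P L) : LInv K P (mergeAll zs L) := by
  induction zs generalizing L with
  | nil => exact hL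
  | cons z zs ih =>
    obtain ⟨h1, h2, h3, h4, h5⟩ := hzs z (by simp)
    exact ih (fun w hw => hzs w (List.mem_cons_of_mem _ hw)) (linv_merge3 hL h1 h2 h3 h4 h5)

/-- The hypotheses on the combinatorial data `(b, c, P)` that the search refutes (see the module docstring). -/
structure Good (K : ℕ) (b c : ℕ → H) (P : ℕ → Λ) : Prop where
  /-- codes of `b` increase -/ sorted : ∀ t, t + 1 < K → E.enc (b t) < E.enc (b (t + 1))
  /-- `c` injective -/ injC : ∀ i j, i < K → j < K → c i = c j → i = j
  /-- `b − c` injective -/ injBC : ∀ i j, i < K → j < K → b i + c j = b j + c i → i = j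
  /-- zero triples are labelled constantly -/
  resp : ∀ i j k, i < K → j < K → k < K → i ≠ j → j ≠ k → i ≠ k → b j + c k = b i + c j →
    P (3 * i) = P (3 * j + 1) ∧ P (3 * j + 1) = P (3 * k + 2)
  /-- the three slots of a triple are labelled differently -/
  dist : ∀ t, t < K → P (3 * t) ≠ P (3 * t + 1) ∧ P (3 * t + 1) ≠ P (3 * t + 2) ∧ P (3 * t) ≠ P (3 * t + 2)

/-- **Soundness of the search.**  Along a prefix that agrees with good data the search cannot return `true`. -/
theorem dfs_sound {K : ℕ} {b c : ℕ → H} {P : ℕ → Λ} (hG : Good E K b c P) :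
    ∀ (r m : ℕ) (B C L : List ℕ), dfs A r m B C L = true → 1 ≤ m → m + r = K →
      B.length = m → (∀ t, t < m → getI B t = E.enc (b t)) →
      C.length = m → (∀ t, t < m → getI C t = E.enc (c t)) → LInv K P L → False := by
  intro r
  induction r with
  | zero => intro m B C L h; rw [dfs_zero] at h; exact absurd h Bool.false_ne_true
  | succ r ih =>
    intro m B C L h hm hK hBl hB hCl hC hL
    have hmK : m < K := by omega
    rw [dfs_succ] at h
    have h1 := allN_true h (E.enc_lt (b m))
    -- sortedness: the new code exceeds the previous one
    have hble : Nat.ble (E.enc (b m)) (getI B (m - 1)) = false := by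
      have hlt : E.enc (b (m - 1)) < E.enc (b m) := by
        have := hG.sorted (m - 1) (by omega)
        rwa [Nat.sub_add_cancel hm] at this
      rw [hB (m - 1) (by omega)]
      cases hb : Nat.ble (E.enc (b m)) (E.enc (b (m - 1)))
      · rfl
      · exact absurd (Nat.le_of_ble_eq_true hb) (not_le.2 hlt)
    rw [hble, Bool.false_or, forceN_eq] at h1
    have h2 := allN_true h1 (E.enc_lt (c m))
    -- injectivity: the new `c`-code is not in the forbidden mask
    have hbit : Nat.testBit (forbMask A B C m (E.enc (b m))) (E.enc (c m)) = false := by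
      cases ht : Nat.testBit (forbMask A B C m (E.enc (b m))) (E.enc (c m))
      · rfl
      · exfalso
        obtain ⟨i, hi, hor⟩ := testBit_forbMask ht
        rcases hor with h0 | h0
        · rw [hC i hi] at h0
          have := hG.injC m i hmK (by omega) (E.inj h0)
          omega
        · rw [hC i hi, hB i hi, E.addC_enc, E.subC_enc] at h0
          have e := E.inj h0
          have := hG.injBC i m (by omega) hmK (by rw [e]; abel)
          omega
    rw [hbit, Bool.false_or, applyMerges_eq] at h2
    -- the merges of the new zero triples keep the label invariant
    have hL' : LInv K P (mergeAll (zeros A B C m (E.enc (b m)) (E.enc (c m))) L) := by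
      refine linv_mergeAll _ (fun z hz => ?_) hL
      rw [zeros_eq] at hz
      obtain ⟨i, j, hi, hj, hij, hz⟩ := mem_zerosLoop hz
      rcases hz with ⟨rfl, hc⟩ | ⟨rfl, hc⟩ | ⟨rfl, hc⟩
      · rw [hB i hi, hC j hj, hC i hi, E.addC_enc, E.addC_enc] at hc
        have := hG.resp m i j hmK (by omega) (by omega) (by omega) hij (by omega) (E.inj hc)
        show m < K ∧ i < K ∧ j < K ∧ P (3 * m) = P (3 * i + 1) ∧ P (3 * i + 1) = P (3 * j + 2)
        exact ⟨hmK, by omega, by omega, this.1, this.2⟩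
      · rw [hC j hj, hB i hi, E.addC_enc, E.addC_enc] at hc
        have := hG.resp i m j (by omega) hmK (by omega) (by omega) (by omega) hij (E.inj hc)
        show i < K ∧ m < K ∧ j < K ∧ P (3 * i) = P (3 * m + 1) ∧ P (3 * m + 1) = P (3 * j + 2)
        exact ⟨by omega, hmK, by omega, this.1, this.2⟩
      · rw [hB j hj, hB i hi, hC j hj, E.addC_enc, E.addC_enc] at hc
        have := hG.resp i j m (by omega) (by omega) hmK hij (by omega) (by omega) (E.inj hc)
        show i < K ∧ j < K ∧ m < K ∧ P (3 * i) = P (3 * j + 1) ∧ P (3 * j + 1) = P (3 * m + 2)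
        exact ⟨by omega, by omega, hmK, this.1, this.2⟩
    -- hence no clash
    have hcl : clash (mergeAll (zeros A B C m (E.enc (b m)) (E.enc (c m))) L) (m + 1) = false := by
      cases hc' : clash (mergeAll (zeros A B C m (E.enc (b m)) (E.enc (c m))) L) (m + 1)
      · rfl
      · exfalso
        obtain ⟨t, ht, hor⟩ := clash_true hc'
        have htK : t < K := by omega
        obtain ⟨d1, d2, d3⟩ := hG.dist t htK
        rcases hor with e | e | e
        exacts [d1 (hL'.2 _ _ (by omega) (by omega) e), d2 (hL'.2 _ _ (by omega) (by omega) e),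
          d3 (hL'.2 _ _ (by omega) (by omega) e)]
    rw [hcl, Bool.false_or, forceL_eq, forceL_eq, snoc_eq, snoc_eq] at h2
    refine ih (m + 1) (B ++ [E.enc (b m)]) (C ++ [E.enc (c m)]) _ h2 (by omega) (by omega) (by simp [hBl])
      (fun t ht => ?_) (by simp [hCl]) (fun t ht => ?_) hL'
    · rcases Nat.lt_succ_iff_lt_or_eq.1 ht with ht | rfl
      · rw [getI_append_left _ (hBl ▸ ht), hB t ht]
      · rw [← hBl, getI_append_length]
    · rcases Nat.lt_succ_iff_lt_or_eq.1 ht with ht | rfl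
      · rw [getI_append_left _ (hCl ▸ ht), hC t ht]
      · rw [← hCl, getI_append_length]

/-- **`check_sound`.**  If the kernel search succeeds, no good `(b, c, P)` with `b 0 = c 0 = 0` exists. -/
theorem check_sound {K : ℕ} (hK : 1 ≤ K) (h : check A K = true) {b c : ℕ → H} {P : ℕ → Λ}
    (hb0 : b 0 = 0) (hc0 : c 0 = 0) (hG : Good E K b c P) : False := by
  refine dfs_sound E hG (K - 1) 1 [0] [0] (List.range (3 * K)) h le_rfl (by omega) rfl (fun t ht => ?_) rfl
    (fun t ht => ?_) ⟨List.length_range, fun u v hu hv huv => ?_⟩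
  · obtain rfl : t = 0 := by omega
    show 0 = E.enc (b 0); rw [hb0, E.enc_zero]
  · obtain rfl : t = 0 := by omega
    show 0 = E.enc (c 0); rw [hc0, E.enc_zero]
  · rw [getI_range hu, getI_range hv] at huv
    rw [huv]
end Sound

end IcosetH

end Summit.MatrixMultiplication.OmegaCensus
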